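import Literature.NumberTheory.Sieve.PolymathSieveAsymptotics
import HarnessLib

/-!
# Theorem 3.14: the `DHL` deduction from tensor weights, with row cancellation

Trunk AntSieve, tooling toward the named fact `Literature.NumberTheory.Sieve.weakDHL_three_two_of_GEH`
(D. H. J. Polymath, Res. Math. Sci. 1:12 (2014) = arXiv:1407.4897, Theorem 3.2(xii)).  The last step of
the proof of Theorem 3.14 (§5.4, p. 23), in the form needed when the tensor-product cutoffs come from a
partition of unity: from cutoffs `f_{i,j}`, the weight `ν = (Σ_j c_j ∏_i λ_{f_{i,j}}(n+h_i))²`, the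
non-prime asymptotic in the `GEH` case (Theorem 3.6(ii), an explicit hypothesis `h36`) and the prime
asymptotic in the `EH` case (Theorem 3.5(i), the tree's `theta_divisorSumWeights_asymptotic`), deduce
`DHL[k, m+1]` via Lemma 3.4.  This generalises `weakDHL_of_tensorWeights_geh`
(`PolymathGEHTensorDHL.lean`): there, a piece `j` is exempted from the support condition of
Theorem 3.5(i) at `i₀` when `f_{i₀,j}(0) = 0`; here the pieces are grouped into ROWS (pieces agreeing in
every coordinate `i ≠ i₀`, via a key `row i₀`), and a whole row is exempted when its aggregated value
`Σ_{j ∈ row} c_j f_{i₀,j}(0)` vanishes.  This is what the printed argument uses: on p. 23 the function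
`f₃ = ∫_{s ≥ t} F₃` vanishes for `t_{i₀} ≤ δ₂/2`, `Σ_{i ≠ i₀} t_i ≥ (1+ε)ϑ/2 - δ₂/2` "from the vanishing
marginal condition", i.e. only the `t_{i₀}`-aggregate of `F₃` over such rows vanishes, not `F₃` itself;
for prime `n + h_{i₀}` beyond the supports, `λ_{f_{i₀,j}}(n + h_{i₀}) = f_{i₀,j}(0)` ((lambdan-prime)), so
`Σ_{j ∈ row} c_j ∏_i λ_{f_{i,j}}(n + h_i) = (Σ_{j ∈ row} c_j f_{i₀,j}(0)) · ∏_{i ≠ i₀} λ_{f_{i,row}}(n + h_i) = 0`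
pointwise, and the same rows contribute `0` to `β_{i₀}`.

## References

* [Polymath8b2014] D. H. J. Polymath, Res. Math. Sci. 1 (2014), Art. 12 = arXiv:1407.4897,
  Theorem 3.14 and §5.4 (p. 23); §5.3 (pp. 21–23) for the `EH` model.
-/

noncomputable section

open MeasureTheory Filter Finset Asymptotics
open scoped BigOperators Topology

namespace Literature.NumberTheory.Sieve

section TensorGEH

variable {ι : Type*}

/-- **The `DHL` deduction of §5.4 (Theorem 3.14), sieve-theoretic part, with row cancellation.**
As `weakDHL_of_tensorWeights_geh`, but the pieces `j ∈ J` carry, for each `i₀`, a row key `row i₀ j`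
such that pieces with the same key have the same cutoffs off `i₀` (`hrowf`) and the same membership in
`𝒥₁(i₀)` (`hrowJ₁`); the support condition of Theorem 3.5(i) at `i₀` (`hsθ`) is only required for pieces
whose ROW aggregate `Σ_{j₂ ∈ J, row i₀ j₂ = row i₀ j} c_{j₂} f_{i₀,j₂}(0)` is non-zero (rows with vanishing
aggregate contribute nothing to `Σ_n ν(n) θ(n + h_{i₀})` once `λ_{f_{i₀,j}}(n + h_{i₀}) = f_{i₀,j}(0)`, nor to
`β_{i₀}`).  (a) `Σ ν(n)` by Theorem 3.6(ii) (`h36`) for each pair with its own exceptional index (`hs1`);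
(b) `Σ ν(n) θ(n + h_{i₀}) ≥ (β_{i₀} - o(1)) B^{1-k} x/φ(W)` by `(x₁ + x₂)² ≥ (x₁ + 2x₂)x₁`, (lambdan-prime)
(`hslt`), row cancellation and Theorem 3.5(i) (`h35`, `EH[ϑ]` as `PrimesHaveLevel ϑ`) termwise on the
remaining rows; (c) Lemma 3.4 (`weakDHL_of_sieveWeights'`) with `m α < β₁ + ⋯ + β_k`. [cite: Polymath8b2014, Theorem 3.14 (proof, §5.4, p. 23)] -/
theorem weakDHL_of_tensorWeights_geh_rows {κ : Type*} [DecidableEq ι] [DecidableEq κ]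
    (h35 : theta_divisorSumWeights_asymptotic)
    {θ : ℝ}
    (h36 : ∀ (H : Finset ℤ), IsAdmissibleTuple H → 1 ≤ #H →
      ∀ (b : ℝ → ℤ), (∀ x, ∀ h ∈ H, Int.gcd (b x + h) (polymathW x) = 1) →
      ∀ h₀ ∈ H, ∀ (F G : ℤ → ℝ → ℝ) (sF sG : ℤ → ℝ),
        (∀ h ∈ H, IsSieveCutoff (F h) (sF h)) → (∀ h ∈ H, IsSieveCutoff (G h) (sG h)) →
        ∑ h ∈ H.erase h₀, (sF h + sG h) < θ →
        (fun x : ℝ => ∑ n ∈ polymathRange x (b x),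
              ∏ h ∈ H, (divisorSumWeight (F h) x ((n : ℤ) + h).toNat *
                divisorSumWeight (G h) x ((n : ℤ) + h).toNat)
            - (∏ h ∈ H, ∫ t in (0 : ℝ)..1, deriv (F h) t * deriv (G h) t) *
              (x / (polymathB x ^ #H * polymathW x)))
          =o[atTop] fun x : ℝ => x / (polymathB x ^ #H * polymathW x))
    {k m : ℕ} (hk : 2 ≤ k) (hm : 1 ≤ m)
    (hθ0 : 0 < θ) (hθ1 : θ < 1) (hθ : PrimesHaveLevel θ)
    (J : Finset ι) (c : ι → ℝ) (f : Fin k → ι → ℝ → ℝ) (s : Fin k → ι → ℝ)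
    (J₁ : Fin k → Finset ι) (hJ₁ : ∀ i, J₁ i ⊆ J)
    (row : Fin k → ι → κ)
    (hrowf : ∀ i₀ i, i ≠ i₀ → ∀ j ∈ J, ∀ j₂ ∈ J, row i₀ j = row i₀ j₂ → f i j = f i j₂)
    (hrowJ₁ : ∀ i₀, ∀ j ∈ J, ∀ j₂ ∈ J, row i₀ j = row i₀ j₂ → j ∈ J₁ i₀ → j₂ ∈ J₁ i₀)
    (hf : ∀ i, ∀ j ∈ J, IsSieveCutoff (f i j) (s i j))
    (hs1 : ∀ j ∈ J, ∀ j' ∈ J, ∃ i₀, ∑ i ∈ univ.erase i₀, (s i j + s i j') < θ)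
    (hslt : ∀ i, ∀ j ∈ J, s i j < 1)
    (hsθ : ∀ i₀, ∀ j ∈ J,
      (∑ j₂ ∈ J.filter (fun j₂ => row i₀ j₂ = row i₀ j), c j₂ * f i₀ j₂ 0) ≠ 0 →
        ∀ j' ∈ J₁ i₀, ∑ i ∈ univ.erase i₀, (s i j + s i j') < θ)
    (hkey : (m : ℝ) * tensorAlpha J c f < ∑ i, tensorBeta J c f J₁ i) :
    WeakDicksonHardyLittlewood k (m + 1) := by
  classical
  refine weakDHL_of_sieveWeights' hk hm fun H hH hcard b hb => ?_
  -- index `H` by `Fin k`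
  set e : Fin k ≃ ↥H := (Finset.equivFinOfCardEq hcard).symm with he
  set emb : Fin k ↪ ℤ := ⟨fun i => (e i : ℤ), fun i j hij => e.injective (Subtype.ext hij)⟩
    with hemb
  have hemb_apply : ∀ i, emb i = (e i : ℤ) := fun i => rfl
  have hmapu : (univ : Finset (Fin k)).map emb = H := by
    ext h
    simp only [Finset.mem_map, Finset.mem_univ, true_and, hemb_apply]
    constructor
    · rintro ⟨i, rfl⟩
      exact (e i).2
    · intro hh
      exact ⟨e.symm ⟨h, hh⟩, by simp⟩
  have hmape : ∀ i₀, (univ.erase i₀).map emb = H.erase (e i₀ : ℤ) := fun i₀ => by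
    rw [Finset.map_erase, hmapu, hemb_apply]
  have hsumH : ∀ g : ℤ → ℝ, ∑ h ∈ H, g h = ∑ i, g (e i) := fun g => by
    have := Finset.sum_map (univ : Finset (Fin k)) emb g
    rwa [hmapu] at this
  have hprodH : ∀ g : ℤ → ℝ, ∏ h ∈ H, g h = ∏ i, g (e i) := fun g => by
    have := Finset.prod_map (univ : Finset (Fin k)) emb g
    rwa [hmapu] at this
  have hsumHe : ∀ (g : ℤ → ℝ) (i₀ : Fin k),
      ∑ h ∈ H.erase (e i₀ : ℤ), g h = ∑ i ∈ univ.erase i₀, g (e i) := fun g i₀ => by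
    have := Finset.sum_map (univ.erase i₀) emb g
    rwa [hmape] at this
  have hprodHe : ∀ (g : ℤ → ℝ) (i₀ : Fin k),
      ∏ h ∈ H.erase (e i₀ : ℤ), g h = ∏ i ∈ univ.erase i₀, g (e i) := fun g i₀ => by
    have := Finset.prod_map (univ.erase i₀) emb g
    rwa [hmape] at this
  -- the functions attached to `h ∈ H`
  set F : ℤ → ι → ℝ → ℝ := fun h => if hh : h ∈ H then f (e.symm ⟨h, hh⟩) else fun _ _ => 0
    with hF
  set S : ℤ → ι → ℝ := fun h => if hh : h ∈ H then s (e.symm ⟨h, hh⟩) else fun _ => 0 with hS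
  have hFe : ∀ i, F (e i) = f i := fun i => by
    simp only [hF, dif_pos (e i).2, Subtype.coe_eta, Equiv.symm_apply_apply]
  have hSe : ∀ i, S (e i) = s i := fun i => by
    simp only [hS, dif_pos (e i).2, Subtype.coe_eta, Equiv.symm_apply_apply]
  have hFS : ∀ h ∈ H, ∀ j ∈ J, IsSieveCutoff (F h j) (S h j) := fun h hh j hj => by
    obtain ⟨i, rfl⟩ : ∃ i, (e i : ℤ) = h := ⟨e.symm ⟨h, hh⟩, by simp⟩
    rw [hFe, hSe]
    exact hf i j hj
  -- the weights `ν(n) = (Σ_j c_j ∏_h λ_{f_{h,j}}(n+h))²`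
  set P : ι → ℝ → ℕ → ℝ := fun j x n =>
    ∏ h ∈ H, divisorSumWeight (F h j) x ((n : ℤ) + h).toNat with hP
  set ν : ℝ → ℕ → ℝ := fun x n => (∑ j ∈ J, c j * P j x n) ^ 2 with hν
  set β : ℤ → ℝ := fun h => if hh : h ∈ H then tensorBeta J c f J₁ (e.symm ⟨h, hh⟩) else 0 with hβ
  have hβe : ∀ i, β (e i) = tensorBeta J c f J₁ i := fun i => by
    simp only [hβ, dif_pos (e i).2, Subtype.coe_eta, Equiv.symm_apply_apply]
  have hk1 : 1 ≤ #H := by omega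
  have hk2 : 2 ≤ #H := by omega
  refine ⟨ν, tensorAlpha J c f, β, fun x n => sq_nonneg _, ?_, ?_, ?_⟩
  · /- upper bound: Theorem 3.6(i) for each pair `(j, j')` -/
    intro δ hδ
    set M : ℝ → ℝ := fun x => x / (polymathB x ^ k * polymathW x) with hM
    have hpair : ∀ j ∈ J, ∀ j' ∈ J,
        (fun x : ℝ => ∑ n ∈ polymathRange x (b x), P j x n * P j' x n -
          (∏ i, ∫ t in (0 : ℝ)..1, deriv (f i j) t * deriv (f i j') t) * M x) =o[atTop] M := by
      intro j hj j' hj'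
      obtain ⟨i₀, hi₀⟩ := hs1 j hj j' hj'
      have h := h36 H hH hk1 b hb (e i₀) (e i₀).2 (fun h => F h j) (fun h => F h j') (fun h => S h j)
        (fun h => S h j') (fun h hh => hFS h hh j hj) (fun h hh => hFS h hh j' hj') ?_
      · rw [hcard] at h
        refine h.congr_left fun x => ?_
        simp only [hP, hM, ← Finset.prod_mul_distrib]
        rw [hprodH (fun h => ∫ t in (0 : ℝ)..1, deriv (F h j) t * deriv (F h j') t)]
        simp only [hFe]
      · rw [hsumHe (fun h => S h j + S h j')]
        simpa only [hSe] using hi₀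
    have hsum : (fun x : ℝ => ∑ n ∈ polymathRange x (b x), ν x n - tensorAlpha J c f * M x)
        =o[atTop] M := by
      have h := IsLittleO.sum fun j hj => IsLittleO.sum fun j' hj' =>
        (hpair j hj j' hj').const_mul_left (c j * c j')
      refine h.congr_left fun x => ?_
      have hI : ∑ n ∈ polymathRange x (b x), ν x n =
          ∑ j ∈ J, ∑ j' ∈ J, c j * c j' * ∑ n ∈ polymathRange x (b x), P j x n * P j' x n := by
        simp only [hν, sq_sum_eq_sum_sum]
        rw [Finset.sum_comm]
        refine Finset.sum_congr rfl fun j _ => ?_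
        rw [Finset.sum_comm]
        refine Finset.sum_congr rfl fun j' _ => ?_
        rw [Finset.mul_sum]
        refine Finset.sum_congr rfl fun n _ => ?_
        ring
      rw [hI, tensorAlpha, Finset.sum_mul, ← Finset.sum_sub_distrib]
      refine Finset.sum_congr rfl fun j _ => ?_
      rw [Finset.sum_mul, ← Finset.sum_sub_distrib]
      refine Finset.sum_congr rfl fun j' _ => ?_
      ring
    filter_upwards [hsum.def hδ, eventually_gt_atTop 1] with x hx hx1
    have hM0 : 0 < M x := by
      have := polymathB_pos hx1
      have := polymathW_pos x
      simp only [hM]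
      positivity
    rw [Real.norm_eq_abs, Real.norm_eq_abs, abs_of_pos hM0] at hx
    have h1 := (abs_sub_le_iff.1 hx).1
    rw [mul_div_assoc]
    change _ ≤ (tensorAlpha J c f + δ) * M x
    linarith
  · /- lower bound: Theorem 3.5(i) for pairs `(j, j')` with `j' ∈ 𝒥₁` -/
    intro h₀ hh₀ δ hδ
    obtain ⟨i₀, hi₀⟩ : ∃ i₀, (e i₀ : ℤ) = h₀ := ⟨e.symm ⟨h₀, hh₀⟩, by simp⟩
    subst hi₀
    set M' : ℝ → ℝ := fun x => x / (polymathB x ^ (k - 1) * Nat.totient (polymathW x)) with hM'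
    -- the row aggregates `R j = Σ_{j₂ ∈ row(j)} c_{j₂} f_{i₀,j₂}(0)`
    obtain ⟨R, hR⟩ : ∃ R : ι → ℝ, ∀ j,
        R j = ∑ j₂ ∈ J.filter (fun j₂ => row i₀ j₂ = row i₀ j), c j₂ * f i₀ j₂ 0 := ⟨_, fun _ => rfl⟩
    -- the pair sums `E(j, j')` and the pair constants `Π(j, j')`
    obtain ⟨E, hE⟩ : ∃ E : ι → ι → ℝ → ℝ, ∀ j j' x, E j j' x =
        ∑ n ∈ polymathRange x (b x), GPY.theta ((n : ℤ) + e i₀).toNat *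
          ∏ h ∈ H.erase (e i₀), (divisorSumWeight (F h j) x ((n : ℤ) + h).toNat *
            divisorSumWeight (F h j') x ((n : ℤ) + h).toNat) := ⟨_, fun _ _ _ => rfl⟩
    obtain ⟨Pr, hPr⟩ : ∃ Pr : ι → ι → ℝ, ∀ j j', Pr j j' =
        ∏ i ∈ univ.erase i₀, ∫ t in (0 : ℝ)..1, deriv (f i j) t * deriv (f i j') t :=
      ⟨_, fun _ _ => rfl⟩
    have hpair : ∀ j ∈ J, R j ≠ 0 → ∀ j' ∈ J₁ i₀,
        (fun x : ℝ => E j j' x - Pr j j' * M' x) =o[atTop] M' := by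
      intro j hj hRj j' hj'
      have hj'J : j' ∈ J := hJ₁ i₀ hj'
      have h := h35 H hH hk2 b hb (e i₀) (e i₀).2 θ hθ0 hθ1 hθ (fun h => F h j) (fun h => F h j')
        (fun h => S h j) (fun h => S h j')
        (fun h hh => hFS h (Finset.mem_of_mem_erase hh) j hj)
        (fun h hh => hFS h (Finset.mem_of_mem_erase hh) j' hj'J) ?_
      · rw [hcard] at h
        refine h.congr_left fun x => ?_
        simp only [hM', hE, hPr]
        rw [hprodHe (fun h => ∫ t in (0 : ℝ)..1, deriv (F h j) t * deriv (F h j') t)]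
        simp only [hFe]
      · rw [hsumHe (fun h => S h j + S h j')]
        rw [hR] at hRj
        simpa only [hSe] using hsθ i₀ j hj hRj j' hj'
    -- scaled version of `hpair` for the pairs in rows with non-zero aggregate
    have hpair' : ∀ j ∈ J.filter (fun j => R j ≠ 0), ∀ j' ∈ J₁ i₀, ∀ (w₀ : ℝ),
        (fun x : ℝ => w₀ * (c j * c j') * (f i₀ j 0 * f i₀ j' 0) * E j j' x -
          w₀ * (c j * c j') * (f i₀ j 0 * f i₀ j' 0) * (Pr j j' * M' x)) =o[atTop] M' := by
      intro j hj j' hj' w₀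
      obtain ⟨hjJ, hRj⟩ := Finset.mem_filter.1 hj
      have := (hpair j hjJ hRj j' hj').const_mul_left (w₀ * (c j * c j') * (f i₀ j 0 * f i₀ j' 0))
      refine this.congr_left fun x => ?_
      ring
    set w : ι → ℝ := fun j => if j ∈ J₁ i₀ then 1 else 2 with hw
    -- row invariance of `F h` off `h₀`, of `w`, of `E(·, j')` and of `Π(·, j')`
    have hFrow : ∀ h ∈ H.erase (e i₀ : ℤ), ∀ j ∈ J, ∀ j₂ ∈ J, row i₀ j = row i₀ j₂ →
        F h j = F h j₂ := by
      intro h hh j hj j₂ hj₂ hr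
      obtain ⟨hne, hhH⟩ := Finset.mem_erase.1 hh
      obtain ⟨i, rfl⟩ : ∃ i, (e i : ℤ) = h := ⟨e.symm ⟨h, hhH⟩, by simp⟩
      rw [hFe]
      refine hrowf i₀ i ?_ j hj j₂ hj₂ hr
      rintro rfl
      exact hne rfl
    have hwrow : ∀ j ∈ J, ∀ j₂ ∈ J, row i₀ j = row i₀ j₂ → w j = w j₂ := by
      intro j hj j₂ hj₂ hr
      have h12 : j ∈ J₁ i₀ ↔ j₂ ∈ J₁ i₀ :=
        ⟨hrowJ₁ i₀ j hj j₂ hj₂ hr, hrowJ₁ i₀ j₂ hj₂ j hj hr.symm⟩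
      by_cases h1 : j ∈ J₁ i₀
      · simp only [hw, if_pos h1, if_pos (h12.1 h1)]
      · simp only [hw, if_neg h1, if_neg (fun h2 => h1 (h12.2 h2))]
    have hErow : ∀ j' x, ∀ j ∈ J, ∀ j₂ ∈ J, row i₀ j = row i₀ j₂ → E j j' x = E j₂ j' x := by
      intro j' x j hj j₂ hj₂ hr
      simp only [hE]
      refine Finset.sum_congr rfl fun n _ => ?_
      congr 1
      exact Finset.prod_congr rfl fun h hh => by rw [hFrow h hh j hj j₂ hj₂ hr]
    have hProw : ∀ j', ∀ j ∈ J, ∀ j₂ ∈ J, row i₀ j = row i₀ j₂ → Pr j j' = Pr j₂ j' := by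
      intro j' j hj j₂ hj₂ hr
      simp only [hPr]
      refine Finset.prod_congr rfl fun i hi => ?_
      rw [hrowf i₀ i (Finset.ne_of_mem_erase hi) j hj j₂ hj₂ hr]
    -- row cancellation: rows with vanishing aggregate contribute nothing
    have hZ : ∀ (K : ι → ℝ), (∀ j ∈ J, ∀ j₂ ∈ J, row i₀ j = row i₀ j₂ → K j = K j₂) →
        ∑ j ∈ J.filter (fun j => R j = 0), K j * (c j * f i₀ j 0) = 0 := by
      intro K hK
      rw [← Finset.sum_fiberwise_of_maps_to (s := J.filter (fun j => R j = 0))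
        (t := (J.filter (fun j => R j = 0)).image (row i₀)) (g := row i₀)
        (fun j hj => Finset.mem_image_of_mem _ hj)]
      refine Finset.sum_eq_zero fun r hr => ?_
      obtain ⟨j₀, hj₀Z, rfl⟩ := Finset.mem_image.1 hr
      obtain ⟨hj₀J, hR0⟩ := Finset.mem_filter.1 hj₀Z
      have hfib : (J.filter (fun j => R j = 0)).filter (fun j => row i₀ j = row i₀ j₀) =
          J.filter (fun j => row i₀ j = row i₀ j₀) := by
        ext j
        simp only [Finset.mem_filter]
        constructor
        · rintro ⟨⟨hjJ, -⟩, hjr⟩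
          exact ⟨hjJ, hjr⟩
        · rintro ⟨hjJ, hjr⟩
          refine ⟨⟨hjJ, ?_⟩, hjr⟩
          have hRR : R j = R j₀ := by
            rw [hR, hR]
            refine Finset.sum_congr ?_ fun _ _ => rfl
            ext j₂
            simp only [Finset.mem_filter, hjr]
          rw [hRR]
          exact hR0
      rw [hfib]
      calc ∑ j ∈ J.filter (fun j => row i₀ j = row i₀ j₀), K j * (c j * f i₀ j 0)
          = ∑ j ∈ J.filter (fun j => row i₀ j = row i₀ j₀), K j₀ * (c j * f i₀ j 0) := by
            refine Finset.sum_congr rfl fun j hj => ?_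
            obtain ⟨hjJ, hjr⟩ := Finset.mem_filter.1 hj
            rw [hK j hjJ j₀ hj₀J hjr]
        _ = K j₀ * R j₀ := by rw [hR, Finset.mul_sum]
        _ = 0 := by rw [hR0, mul_zero]
    have hT : (fun x : ℝ => ∑ j ∈ J, ∑ j' ∈ J₁ i₀, w j * (c j * c j') * (f i₀ j 0 * f i₀ j' 0) *
          E j j' x - tensorBeta J c f J₁ i₀ * M' x) =o[atTop] M' := by
      have h := IsLittleO.sum fun j hj => IsLittleO.sum fun j' hj' => hpair' j hj j' hj' (w j)
      refine h.congr_left fun x => ?_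
      -- the full double sum minus `β M'`, as a double sum of differences
      have hfull : ∑ j ∈ J, ∑ j' ∈ J₁ i₀, w j * (c j * c j') * (f i₀ j 0 * f i₀ j' 0) * E j j' x -
          tensorBeta J c f J₁ i₀ * M' x =
          ∑ j ∈ J, ∑ j' ∈ J₁ i₀, (w j * (c j * c j') * (f i₀ j 0 * f i₀ j' 0) * E j j' x -
            w j * (c j * c j') * (f i₀ j 0 * f i₀ j' 0) * (Pr j j' * M' x)) := by
        rw [tensorBeta, Finset.sum_mul, ← Finset.sum_sub_distrib]
        refine Finset.sum_congr rfl fun j _ => ?_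
        rw [Finset.sum_mul, ← Finset.sum_sub_distrib]
        refine Finset.sum_congr rfl fun j' _ => ?_
        simp only [hw, hPr]
        ring
      -- the rows with vanishing aggregate drop out
      have hzero : ∑ j ∈ J.filter (fun j => R j = 0), ∑ j' ∈ J₁ i₀,
          (w j * (c j * c j') * (f i₀ j 0 * f i₀ j' 0) * E j j' x -
            w j * (c j * c j') * (f i₀ j 0 * f i₀ j' 0) * (Pr j j' * M' x)) = 0 := by
        rw [Finset.sum_comm]
        refine Finset.sum_eq_zero fun j' _ => ?_
        have h0 := hZ (fun j => w j * (c j' * f i₀ j' 0) * (E j j' x - Pr j j' * M' x))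
          (fun j hj j₂ hj₂ hr => by
            rw [hwrow j hj j₂ hj₂ hr, hErow j' x j hj j₂ hj₂ hr, hProw j' j hj j₂ hj₂ hr])
        refine Eq.trans (Finset.sum_congr rfl fun j _ => ?_) h0
        ring
      rw [hfull, ← Finset.sum_filter_add_sum_filter_not J (fun j => R j ≠ 0)]
      have hnot : J.filter (fun j => ¬R j ≠ 0) = J.filter (fun j => R j = 0) :=
        Finset.filter_congr fun j _ => not_ne_iff
      rw [hnot, hzero, add_zero]
    -- for large `x` the cutoffs see `n + h₀` as a prime beyond their support
    have hlarge : ∀ᶠ x : ℝ in atTop, 1 < x ∧ 4 * |((e i₀ : ℤ) : ℝ)| ≤ x ∧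
        ∀ j ∈ J, 3 * x ^ (s i₀ j) ≤ x := by
      refine (eventually_gt_atTop 1).and ((eventually_ge_atTop _).and
        ((Finset.eventually_all J).2 fun j hj => ?_))
      have hs : s i₀ j < 1 := hslt i₀ j hj
      have ht : Tendsto (fun x : ℝ => x ^ (1 - s i₀ j)) atTop atTop :=
        tendsto_rpow_atTop (by linarith)
      filter_upwards [ht.eventually_ge_atTop 3, eventually_gt_atTop 0] with x hx hx0
      calc 3 * x ^ s i₀ j ≤ x ^ (1 - s i₀ j) * x ^ s i₀ j := by gcongr
        _ = x := by rw [← Real.rpow_add hx0]; simp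
    filter_upwards [hT.def hδ, hlarge] with x hx ⟨hx1, hxh, hxs⟩
    have hM'0 : 0 < M' x := by
      have := polymathB_pos hx1
      have := totient_polymathW_pos x
      simp only [hM']
      positivity
    rw [Real.norm_eq_abs, Real.norm_eq_abs, abs_of_pos hM'0] at hx
    have hTge := (abs_sub_le_iff.1 hx).2
    rw [hβe, mul_div_assoc]
    change (tensorBeta J c f J₁ i₀ - δ) * M' x ≤ _
    refine le_trans (by linarith [hTge]) ?_
    -- `T(x) ≤ Σ_n ν(n) θ(n + h₀)`, pointwise in `n`
    have hpt : ∀ n ∈ polymathRange x (b x),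
        ∑ j ∈ J, ∑ j' ∈ J₁ i₀, w j * (c j * c j') * (f i₀ j 0 * f i₀ j' 0) *
          (GPY.theta ((n : ℤ) + e i₀).toNat *
            ∏ h ∈ H.erase (e i₀), (divisorSumWeight (F h j) x ((n : ℤ) + h).toNat *
              divisorSumWeight (F h j') x ((n : ℤ) + h).toNat)) ≤
        ν x n * GPY.theta ((n : ℤ) + e i₀).toNat := by
      intro n hn
      obtain ⟨hxn, hn2⟩ := le_of_mem_polymathRange (by linarith) hn
      by_cases hprime : ((n : ℤ) + e i₀).toNat.Prime
      · have hq_gt : ∀ j ∈ J, x ^ s i₀ j < ((n : ℤ) + e i₀).toNat := by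
          intro j hj
          have h0 : (0 : ℝ) ≤ n + ((e i₀ : ℤ) : ℝ) := by
            linarith [neg_abs_le (((e i₀ : ℤ) : ℝ)), abs_nonneg (((e i₀ : ℤ) : ℝ))]
          have h1 : ((((n : ℤ) + e i₀).toNat : ℕ) : ℝ) = n + ((e i₀ : ℤ) : ℝ) := by
            have : ((((n : ℤ) + e i₀).toNat : ℕ) : ℤ) = n + e i₀ :=
              Int.toNat_of_nonneg (by exact_mod_cast h0)
            exact_mod_cast this
          rw [h1]
          have := hxs j hj
          linarith [neg_abs_le (((e i₀ : ℤ) : ℝ)), Real.rpow_nonneg (by linarith : (0:ℝ) ≤ x) (s i₀ j)]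
        have hPj : ∀ j ∈ J, P j x n = f i₀ j 0 *
            ∏ h ∈ H.erase (e i₀ : ℤ), divisorSumWeight (F h j) x ((n : ℤ) + h).toNat := by
          intro j hj
          simp only [hP]
          rw [← Finset.mul_prod_erase H _ (e i₀).2, hFe,
            divisorSumWeight_prime_eq (hf i₀ j hj).eq_zero hx1 hprime (hq_gt j hj)]
        calc ∑ j ∈ J, ∑ j' ∈ J₁ i₀, w j * (c j * c j') * (f i₀ j 0 * f i₀ j' 0) *
              (GPY.theta ((n : ℤ) + e i₀).toNat *
                ∏ h ∈ H.erase (e i₀), (divisorSumWeight (F h j) x ((n : ℤ) + h).toNat *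
                  divisorSumWeight (F h j') x ((n : ℤ) + h).toNat))
            = (∑ j ∈ J, w j * (c j * P j x n)) * (∑ j' ∈ J₁ i₀, c j' * P j' x n) *
                GPY.theta ((n : ℤ) + e i₀).toNat := by
              rw [Finset.sum_mul, Finset.sum_mul]
              refine Finset.sum_congr rfl fun j hj => ?_
              rw [Finset.mul_sum, Finset.sum_mul]
              refine Finset.sum_congr rfl fun j' hj' => ?_
              rw [hPj j hj, hPj j' (hJ₁ i₀ hj'), Finset.prod_mul_distrib]
              ring
          _ ≤ ν x n * GPY.theta ((n : ℤ) + e i₀).toNat := by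
              have hsplit : ∑ j ∈ J, c j * P j x n =
                  ∑ j ∈ J₁ i₀, c j * P j x n + ∑ j ∈ J.filter (· ∉ J₁ i₀), c j * P j x n := by
                rw [← Finset.sum_filter_add_sum_filter_not J (· ∈ J₁ i₀), Finset.filter_mem_eq_inter,
                  Finset.inter_eq_right.2 (hJ₁ i₀)]
              have hsplit' : ∑ j ∈ J, w j * (c j * P j x n) =
                  ∑ j ∈ J₁ i₀, c j * P j x n + 2 * ∑ j ∈ J.filter (· ∉ J₁ i₀), c j * P j x n := by
                simp only [hw, ite_mul, one_mul]
                rw [Finset.sum_ite, Finset.filter_mem_eq_inter, Finset.inter_eq_right.2 (hJ₁ i₀),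
                  ← Finset.mul_sum]
              rw [hsplit', hν]
              simp only
              rw [hsplit]
              exact mul_le_mul_of_nonneg_right (add_sq_ge _ _) (GPY.theta_nonneg _)
      · simp [GPY.theta_of_not_prime hprime]
    calc ∑ j ∈ J, ∑ j' ∈ J₁ i₀, w j * (c j * c j') * (f i₀ j 0 * f i₀ j' 0) * E j j' x
        = ∑ n ∈ polymathRange x (b x), ∑ j ∈ J, ∑ j' ∈ J₁ i₀,
            w j * (c j * c j') * (f i₀ j 0 * f i₀ j' 0) *
              (GPY.theta ((n : ℤ) + e i₀).toNat *
                ∏ h ∈ H.erase (e i₀), (divisorSumWeight (F h j) x ((n : ℤ) + h).toNat *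
                  divisorSumWeight (F h j') x ((n : ℤ) + h).toNat)) := by
          symm
          rw [Finset.sum_comm]
          refine Finset.sum_congr rfl fun j _ => ?_
          rw [Finset.sum_comm]
          refine Finset.sum_congr rfl fun j' _ => ?_
          rw [hE, Finset.mul_sum]
      _ ≤ ∑ n ∈ polymathRange x (b x), ν x n * GPY.theta ((n : ℤ) + e i₀).toNat :=
          Finset.sum_le_sum hpt
  · /- the key inequality -/
    rw [hsumH β]
    simpa only [hβe] using hkey

end TensorGEH

end Literature.NumberTheory.Sieve
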